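import Summits.NavierStokesRegularity.NavierStokesRegularity.Theorems.ExtremiserTransienceAnalyticGapDefs
import Summits.NavierStokesRegularity.NavierStokesRegularity.Theorems.ExtremiserTransienceSparseSliceTransfer
import Literature.Analysis.FluidPDE.TubeSliceCauchyEstimates
import Literature.Analysis.FluidPDE.Grujic2013AnalyticRestarts
import HarnessLib

/-!
# Route `ExtremiserTransience`, crux `NearExtremalTransiencePerFlow` (stmt-NavierStokesRegularity-26567), LINE g8-β «analytic gap»:
# STUB S-A `SparseAnalyticTransfer` PROVED (by name, over the texts of record)

`--supports stmt-NavierStokesRegularity-26567` (helper: LINE g8-β = crux workfile `Cruxes/NearExtremalTransiencePerFlow/Lines/analytic_gap.lean`,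
PASS idea-crit-4 2026-08-28T21:45:37Z; not the registered skeleton of record).  Author: prover seat `ns-net-p1` (g2).

`sparseAnalyticTransfer : SparseAnalyticTransfer` (texts of record `…Theorems.NearExtremalTransiencePerFlow.AnalyticGap.*`; in the workfile
`theorem stub_sparseAnalyticTransfer : SparseAnalyticTransfer := sparseAnalyticTransfer` closes by definitional unfolding): given S-E, a
violator flow has FLOW-UNIFORM `ρ ∈ (0,1]`, `N_sp > 0` such that for every `ε > 0` some late slice `u(t)` with bounds `M, B` is admissible,
`ρ`-ANALYTIC-REGULAR (`‖Dʲu(t)‖ ≤ j!·ρ^{-j}·M·λ^{-j}`), `N_sp`-sparse, non-degenerate and `(κ⋆−ε)`-efficient.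

THE PROOF — NO new Literature fact is needed (the critic's «modulo typing GK98 Thm 3.6» is discharged by what the tree already holds):
* Guberović's `L^∞` analyticity radius restarted along the classical flow (`Grujic2013.hasAnalyticRestarts_of_classical`, PROVED in the tree
  over `guberovic2010_analyticity_radius_holds`): from `t' = t − (T−t)/(2c₀²C'²)` (`C' = max C 1`; window condition by the Type-I bound
  `‖u(t')‖_∞ ≤ C'√ν/√(T−t')`), the slice `u(t)` is the real slice of a map holomorphic on the complex tube of radius
  `r = c₀⁻¹√(ν(t−t')) = √(ν(T−t))/(√2 c₀² C')` and bounded there by `c₀‖u(t')‖_∞ ≤ c₀C'√ν/√(T−t) ≤ (c₀C'/c_L)·M` (Leray's lower rate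
  `c_L√ν ≤ √(T−t)M`, `lerayLowerRate_of_not_extends`);
* the tube Cauchy estimates `‖Dʲu(t)‖ ≤ B·e·(2e/r)ʲ·j!` (`norm_iteratedFDeriv_slice_le_factorial_of_tube`, landed p673182);
* the upper scale lock `λ ≤ Θ'√(ν(T−t))` at S-E's time converts `r^{-j}` into `λ^{-j}`: `ρ = (K₀·K₁·Θ')⁻¹` with `K₀ = max 1 (c₀C'e/c_L)`,
  `K₁ = 2√2·e·c₀²·C'` — flow-uniform;
* admissibility (budgets `stub_taoCover`) and sparseness `N_sp = Θ'²N₁/c_L²` exactly as in the sparse transfer `SparseBangBang.sparseSliceTransfer`.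
HONEST FRAMING: an implication between statements about hypothetical Type-I singular flows (S-E is the line's OPEN HEART); nothing about
Navier–Stokes regularity or blow-up is proved; no summit is proved by a line. [folklore]
-/

noncomputable section

open scoped Topology InnerProductSpace RealInnerProductSpace ENNReal ContDiff Nat
open MeasureTheory Filter Set Metric Function
open Literature.Analysis Literature.Analysis.FluidPDE
open Literature.Analysis.FunctionSpaces.EuclideanSpace (complexify)
open Summit.NavierStokesRegularity.NavierStokesRegularity.Theorems.DepletionLadder.KStar
open Summit.NavierStokesRegularity.NavierStokesRegularity.Theorems.DepletionLadder.KStar.HalfSpace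
open Summit.NavierStokesRegularity.NavierStokesRegularity.Theorems.DepletionLadder.KStar.BangBang
open Summit.NavierStokesRegularity.NavierStokesRegularity.Theorems.NearExtremalTransiencePerFlow.ZoneTransversality (PFC IsViolator)
open Summit.NavierStokesRegularity.NavierStokesRegularity.Theorems.NearExtremalTransiencePerFlow.SparseBangBang

namespace Summit.NavierStokesRegularity.NavierStokesRegularity.Theorems.NearExtremalTransiencePerFlow.AnalyticGap

-- the problem directory repeats the summit name (`NavierStokesRegularity/NavierStokesRegularity`)
set_option linter.dupNamespace false

/-- Pure real arithmetic of the window: with `C' ≥ 1`, `c₀ > 1`, the restart gap `τ = (T−t)/(2c₀²C'²)` satisfies `τ ≤ (T−t)/2` and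
`c₀⁻¹√(ντ) = √(ν(T−t)) / (√2·c₀²·C')`. [folklore] -/
theorem restart_radius_eq {ν c₀ C' X : ℝ} (hν : 0 < ν) (hc₀ : 0 < c₀) (hC' : 0 < C') (hX : 0 < X) :
    c₀⁻¹ * Real.sqrt (ν * (X / (2 * c₀ ^ 2 * C' ^ 2))) = Real.sqrt (ν * X) / (Real.sqrt 2 * c₀ ^ 2 * C') := by
  have h1 : ν * (X / (2 * c₀ ^ 2 * C' ^ 2)) = (ν * X) / (Real.sqrt 2 * c₀ * C') ^ 2 := by
    rw [mul_pow, mul_pow, Real.sq_sqrt (by norm_num : (0:ℝ) ≤ 2)]; ring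
  rw [h1, Real.sqrt_div' _ (sq_nonneg _), Real.sqrt_sq (by positivity)]
  field_simp

/-- **S-A `SparseAnalyticTransfer` of LINE g8-β, PROVED** (see the module docstring). [folklore] -/
theorem sparseAnalyticTransfer : SparseAnalyticTransfer := by
  intro hSE C ν T u p hV
  have hV' := hV
  obtain ⟨hC, hν, hT, hsol, hLH, hdec, hrate, hext, hno⟩ := hV'
  have hsν : 0 < Real.sqrt ν := Real.sqrt_pos.2 hν
  have hK : 0 < kStar := kStar_pos
  set C' : ℝ := max C 1 with hC'def
  have hC'1 : 1 ≤ C' := le_max_right _ _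
  have hC'pos : 0 < C' := lt_of_lt_of_le one_pos hC'1
  have hCC' : C ≤ C' := le_max_left _ _
  -- ### per-flow constants
  obtain ⟨cL, hcL, hler⟩ := DepletionLadder.PerFlow.lerayLowerRate_of_not_extends hν hT hsol hLH hdec hext
  obtain ⟨tB, htB, hsubB⟩ := mem_nhdsLT_iff_exists_Ioo_subset.1 hrate
  have htBT : tB < T := htB
  have hbdd : ∀ T₂ ∈ Ioo 0 T, ∃ M : ℝ, ∀ t ∈ Icc 0 T₂, ∀ y, ‖u t y‖ ≤ M :=
    exists_forall_norm_le_of_tao2011 tao2011_hasBoundedSobolevNormsOn_holds hν hsol hLH hdec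
  -- Guberović's analyticity radius, restarted along the flow
  obtain ⟨c₀, hc₀1, hAR⟩ := Grujic2013.hasAnalyticRestarts_of_classical
  have hc₀ : 0 < c₀ := one_pos.trans hc₀1
  have hrestart : Grujic2013.HasAnalyticRestarts c₀ ν T u := by
    refine hAR hν hT (hsol.mono Ioo_subset_Ico_self isOpen_Ioo.uniqueDiffOn) (fun a b ha hab hbT => ?_)
      (fun a b ha hab hbT => ?_)
    · obtain ⟨Mab, hMab⟩ := hbdd b ⟨ha.trans_le hab, hbT⟩
      exact ⟨Mab, fun t ht x => hMab t ⟨ha.le.trans ht.1, ht.2⟩ x⟩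
    · exact ⟨ENNReal.ofReal (2 * VectorCalculus.kineticEnergy (u 0)), ENNReal.ofReal_lt_top, fun t ht =>
        hLH.lintegral_enorm_sq_le hν.le ⟨ha.le.trans ht.1, ht.2.trans hbT.le⟩⟩
  -- the sparse efficient times of the flow (S-E)
  obtain ⟨N₀, Θ, hSEu⟩ := hSE C ν T u p hV
  set Θ' : ℝ := max Θ 1 with hΘ'def
  have hΘ'1 : 1 ≤ Θ' := le_max_right _ _
  have hΘ'pos : 0 < Θ' := lt_of_lt_of_le one_pos hΘ'1
  have hΘΘ' : Θ ≤ Θ' := le_max_left _ _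
  set N₁ : ℝ := max N₀ 1 with hN₁def
  have hN₁1 : 1 ≤ N₁ := le_max_right _ _
  have hN₀N₁ : N₀ ≤ N₁ := le_max_left _ _
  set Nsp : ℝ := Θ' ^ 2 * N₁ / cL ^ 2 with hNspdef
  have hNsp : 0 < Nsp := by positivity
  -- the analyticity parameter `ρ = (K₀ K₁ Θ')⁻¹`
  set K₀ : ℝ := max 1 (c₀ * C' * Real.exp 1 / cL) with hK₀def
  have hK₀1 : 1 ≤ K₀ := le_max_left _ _
  have hK₀pos : 0 < K₀ := lt_of_lt_of_le one_pos hK₀1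
  set K₁ : ℝ := 2 * Real.exp 1 * (Real.sqrt 2 * c₀ ^ 2 * C') with hK₁def
  have hK₁1 : 1 ≤ K₁ := by
    have he : 1 ≤ Real.exp 1 := Real.one_le_exp (by norm_num)
    have h2 : 1 ≤ Real.sqrt 2 := Real.one_le_sqrt.2 (by norm_num)
    have hc : 1 ≤ c₀ ^ 2 := one_le_pow₀ hc₀1.le
    have h3 : 1 ≤ Real.sqrt 2 * c₀ ^ 2 * C' := one_le_mul_of_one_le_of_one_le (one_le_mul_of_one_le_of_one_le h2 hc) hC'1
    have h4 : (1 : ℝ) ≤ 2 * Real.exp 1 := by linarith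
    exact one_le_mul_of_one_le_of_one_le h4 h3
  have hK₁pos : 0 < K₁ := lt_of_lt_of_le one_pos hK₁1
  set ρ : ℝ := (K₀ * K₁ * Θ')⁻¹ with hρdef
  have hprod1 : 1 ≤ K₀ * K₁ * Θ' := one_le_mul_of_one_le_of_one_le (one_le_mul_of_one_le_of_one_le hK₀1 hK₁1) hΘ'1
  have hprodpos : 0 < K₀ * K₁ * Θ' := lt_of_lt_of_le one_pos hprod1
  have hρpos : 0 < ρ := inv_pos.2 hprodpos
  have hρ1 : ρ ≤ 1 := inv_le_one_of_one_le₀ hprod1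
  have hρinv : ρ⁻¹ = K₀ * K₁ * Θ' := inv_inv _
  refine ⟨ρ, Nsp, hρpos, hρ1, hNsp, fun ε hε => ?_⟩
  -- ### a sparse two-sided-locked `(κ⋆−ε)`-efficient late time
  set t₂ : ℝ := max (T / 2) ((tB + T) / 2) with ht₂def
  have ht₂T : t₂ < T := max_lt (by linarith) (by linarith)
  have ht₂0 : 0 ≤ t₂ := le_trans (by linarith : (0 : ℝ) ≤ T / 2) (le_max_left _ _)
  obtain ⟨t, ht, hsparse, hlockl, hlocku, M, hM, hpos, heff⟩ := hSEu ε hε t₂ ⟨ht₂0, ht₂T⟩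
  have htT : t < T := ht.2
  have hTt : 0 < T - t := sub_pos.2 htT
  have htT2 : T / 2 ≤ t := (le_max_left _ _).trans ht.1
  have htB2 : (tB + T) / 2 ≤ t := (le_max_right _ _).trans ht.1
  have htI : t ∈ Set.Ico 0 T := ⟨by linarith, htT⟩
  have hsT : 0 < Real.sqrt (T - t) := Real.sqrt_pos.2 hTt
  set Z : ℝ := Zen (u t) with hZdef
  set P : ℝ := Wpa (u t) with hPdef
  set X : ℝ := ν * (T - t) with hXdef
  have hX : 0 < X := mul_pos hν hTt
  have hsX : Real.sqrt X = Real.sqrt ν * Real.sqrt (T - t) := Real.sqrt_mul hν.le _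
  have hsXpos : 0 < Real.sqrt X := Real.sqrt_pos.2 hX
  -- positivity of `M`, `Z`, `P`; `Θ > 0`
  have hMnn : 0 ≤ M := (norm_nonneg _).trans (hM 0)
  have hM0 : 0 < M := by
    rcases hMnn.eq_or_lt with h | h
    · rw [← h, zero_mul, zero_mul] at hpos; exact absurd hpos (lt_irrefl _)
    · exact h
  have hsZ : 0 < Real.sqrt Z := by
    rcases (Real.sqrt_nonneg Z).eq_or_lt with h | h
    · rw [← h, mul_zero, zero_mul] at hpos; exact absurd hpos (lt_irrefl _)
    · exact h
  have hsP : 0 < Real.sqrt P := by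
    rcases (Real.sqrt_nonneg P).eq_or_lt with h | h
    · rw [← h, mul_zero] at hpos; exact absurd hpos (lt_irrefl _)
    · exact h
  have hZ : 0 < Z := Real.sqrt_pos.1 hsZ
  have hP : 0 < P := Real.sqrt_pos.1 hsP
  have hΘ : 0 < Θ := by
    by_contra h
    push Not at h
    have : Θ * (ν * (T - t)) * Wpa (u t) ≤ 0 :=
      mul_nonpos_of_nonpos_of_nonneg (mul_nonpos_of_nonpos_of_nonneg h hX.le) hP.le
    linarith
  have hsparse' : Z * Real.sqrt (T - t) ≤ N₁ * (ν * Real.sqrt ν) :=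
    hsparse.trans (mul_le_mul_of_nonneg_right hN₀N₁ (by positivity))
  -- the Taylor length in parabolic units
  have hlamZP : lam (u t) = Real.sqrt (Z / P) := rfl
  obtain ⟨hlamU, hlamL⟩ := sqrt_div_bounds_of_lock hP hX hΘ hΘΘ' hΘ'1 hlockl hlocku
  rw [← hlamZP] at hlamU hlamL
  have hlam : 0 < lam (u t) := lt_of_lt_of_le (div_pos hsXpos hΘ'pos) hlamL
  have hqle : (Real.sqrt X)⁻¹ ≤ Θ' * (lam (u t))⁻¹ := by
    rw [← div_eq_mul_inv, le_div_iff₀ hlam, inv_mul_le_iff₀ hsXpos, mul_comm]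
    exact hlamU
  -- Leray at `t`
  have hpinl : cL * Real.sqrt ν ≤ Real.sqrt (T - t) * M := by
    obtain ⟨xL, hxL⟩ := hler t htI
    exact hxL.trans (mul_le_mul_of_nonneg_left (hM xL) (Real.sqrt_nonneg _))
  have hsle : Real.sqrt ν / Real.sqrt (T - t) ≤ M / cL := by
    rw [div_le_div_iff₀ hsT hcL]
    calc Real.sqrt ν * cL = cL * Real.sqrt ν := mul_comm _ _
      _ ≤ Real.sqrt (T - t) * M := hpinl
      _ = M * Real.sqrt (T - t) := mul_comm _ _
  -- ### the restart time `t' = t − (T−t)/(2c₀²C'²)` and the tube extension of `u t`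
  set τ : ℝ := (T - t) / (2 * c₀ ^ 2 * C' ^ 2) with hτdef
  have hτpos : 0 < τ := by positivity
  have hD0 : 0 < c₀ ^ 2 * C' ^ 2 := by positivity
  have hD1 : 1 ≤ c₀ ^ 2 * C' ^ 2 := one_le_mul_of_one_le_of_one_le (one_le_pow₀ hc₀1.le) (one_le_pow₀ hC'1)
  have hτle : τ ≤ (T - t) / 2 := by
    rw [hτdef, div_le_div_iff₀ (by positivity) (by norm_num)]
    have h2D : (2 : ℝ) ≤ 2 * (c₀ ^ 2 * C' ^ 2) := by linarith
    calc (T - t) * 2 ≤ (T - t) * (2 * (c₀ ^ 2 * C' ^ 2)) := mul_le_mul_of_nonneg_left h2D hTt.le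
      _ = (T - t) * (2 * c₀ ^ 2 * C' ^ 2) := by ring
  set t' : ℝ := t - τ with ht'def
  have ht't : t' < t := by rw [ht'def]; linarith
  have ht'T : t' < T := ht't.trans htT
  have hTt' : 0 < T - t' := sub_pos.2 ht'T
  have hTt'ge : T - t ≤ T - t' := by linarith
  have ht'B : tB < t' := by
    have : t' ≥ t - (T - t) / 2 := by rw [ht'def]; linarith
    linarith
  have ht'0 : 0 < t' := by
    have : t' ≥ t - (T - t) / 2 := by rw [ht'def]; linarith
    linarith
  have htt' : t - t' = τ := by rw [ht'def]; ring
  -- `‖u(t')‖_∞` : bounded by the Type-I height, positive by Leray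
  have hsT' : 0 < Real.sqrt (T - t') := Real.sqrt_pos.2 hTt'
  have hMt' : ∀ x, ‖u t' x‖ ≤ C' * Real.sqrt ν / Real.sqrt (T - t') := fun x => by
    have h := hsubB ⟨ht'B, ht'T⟩ x
    rw [le_div_iff₀ hsT', mul_comm]
    exact h.trans (mul_le_mul_of_nonneg_right hCC' hsν.le)
  have hbddN : BddAbove (Set.range fun x => ‖u t' x‖) := ⟨_, by rintro _ ⟨x, rfl⟩; exact hMt' x⟩
  set N' : ℝ := ⨆ x, ‖u t' x‖ with hN'def
  have hN'le : N' ≤ C' * Real.sqrt ν / Real.sqrt (T - t') := ciSup_le hMt'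
  have hleN' : ∀ x, ‖u t' x‖ ≤ N' := fun x => le_ciSup hbddN x
  have hN'pos : 0 < N' := by
    obtain ⟨xL, hxL⟩ := hler t' ⟨ht'0.le, ht'T⟩
    have h1 : 0 < Real.sqrt (T - t') * ‖u t' xL‖ := lt_of_lt_of_le (mul_pos hcL hsν) hxL
    exact lt_of_lt_of_le ((mul_pos_iff_of_pos_left hsT').1 h1) (hleN' xL)
  -- the window condition `t < t' + ν/(c₀² N'²)`
  have hwin : t < t' + ν / (c₀ ^ 2 * N' ^ 2) := by
    have h1 : N' ^ 2 ≤ C' ^ 2 * ν / (T - t') := by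
      have h := pow_le_pow_left₀ hN'pos.le hN'le 2
      rwa [div_pow, mul_pow, Real.sq_sqrt hν.le, Real.sq_sqrt hTt'.le] at h
    have h2 : (T - t') / (c₀ ^ 2 * C' ^ 2) ≤ ν / (c₀ ^ 2 * N' ^ 2) := by
      rw [div_le_div_iff₀ (by positivity) (by positivity)]
      have h3 := mul_le_mul_of_nonneg_left h1 (le_of_lt (mul_pos (pow_pos hc₀ 2) hTt'))
      calc (T - t') * (c₀ ^ 2 * N' ^ 2) = c₀ ^ 2 * (T - t') * N' ^ 2 := by ring
        _ ≤ c₀ ^ 2 * (T - t') * (C' ^ 2 * ν / (T - t')) := h3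
        _ = ν * (c₀ ^ 2 * C' ^ 2) := by field_simp
    have h4 : τ < (T - t') / (c₀ ^ 2 * C' ^ 2) := by
      rw [hτdef, div_lt_div_iff₀ (by positivity) hD0]
      have hA : 0 < (T - t) * (c₀ ^ 2 * C' ^ 2) := mul_pos hTt hD0
      have hB : (T - t) * (c₀ ^ 2 * C' ^ 2) ≤ (T - t') * (c₀ ^ 2 * C' ^ 2) :=
        mul_le_mul_of_nonneg_right hTt'ge hD0.le
      calc (T - t) * (c₀ ^ 2 * C' ^ 2) < 2 * ((T - t') * (c₀ ^ 2 * C' ^ 2)) := by linarith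
        _ = (T - t') * (2 * c₀ ^ 2 * C' ^ 2) := by ring
    linarith [htt', h4, h2]
  obtain ⟨U, hUd, hUf, hUB⟩ := hrestart t' ⟨ht'0, ht'T⟩ t ⟨ht't, htT⟩ hwin
  -- the radius and the bound of the tube
  set r : ℝ := c₀⁻¹ * Real.sqrt (ν * (t - t')) with hrdef
  have hr : 0 < r := mul_pos (inv_pos.2 hc₀) (Real.sqrt_pos.2 (mul_pos hν (by linarith)))
  have hreq : r = Real.sqrt X / (Real.sqrt 2 * c₀ ^ 2 * C') := by
    rw [hrdef, htt', hτdef]; exact restart_radius_eq hν hc₀ hC'pos hTt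
  have hBle : c₀ * N' * Real.exp 1 ≤ K₀ * M := by
    have h1 : N' ≤ C' * (M / cL) := by
      calc N' ≤ C' * Real.sqrt ν / Real.sqrt (T - t') := hN'le
        _ = C' * (Real.sqrt ν / Real.sqrt (T - t')) := mul_div_assoc _ _ _
        _ ≤ C' * (Real.sqrt ν / Real.sqrt (T - t)) :=
            mul_le_mul_of_nonneg_left (div_le_div_of_nonneg_left hsν.le hsT (Real.sqrt_le_sqrt hTt'ge)) hC'pos.le
        _ ≤ C' * (M / cL) := mul_le_mul_of_nonneg_left hsle hC'pos.le
    calc c₀ * N' * Real.exp 1 ≤ c₀ * (C' * (M / cL)) * Real.exp 1 := by gcongr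
      _ = c₀ * C' * Real.exp 1 / cL * M := by ring
      _ ≤ K₀ * M := mul_le_mul_of_nonneg_right (le_max_right _ _) hM0.le
  have hratio : 2 * Real.exp 1 / r ≤ K₁ * Θ' * (lam (u t))⁻¹ := by
    have hx0 : Real.sqrt X ≠ 0 := hsXpos.ne'
    have hc0 : c₀ ≠ 0 := hc₀.ne'
    have hC0 : C' ≠ 0 := hC'pos.ne'
    have h2 : Real.sqrt 2 ≠ 0 := (Real.sqrt_pos.2 (by norm_num : (0:ℝ) < 2)).ne'
    have e1 : 2 * Real.exp 1 / r = K₁ * (Real.sqrt X)⁻¹ := by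
      rw [hreq, hK₁def]
      field_simp
    rw [e1]
    calc K₁ * (Real.sqrt X)⁻¹ ≤ K₁ * (Θ' * (lam (u t))⁻¹) := mul_le_mul_of_nonneg_left hqle hK₁pos.le
      _ = K₁ * Θ' * (lam (u t))⁻¹ := (mul_assoc _ _ _).symm
  -- ### the analytic budget of the slice
  have hD : ∀ (j : ℕ) (x : EuclideanSpace ℝ (Fin 3)), ‖iteratedFDeriv ℝ j (u t) x‖ ≤
      c₀ * N' * Real.exp 1 * (2 * Real.exp 1 / r) ^ j * j ! :=
    fun j x => norm_iteratedFDeriv_slice_le_factorial_of_tube hr hUd hUf hUB j x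
  have hAn : IsAnalyticReg ρ (u t) M := by
    intro j x
    rcases Nat.eq_zero_or_pos j with hj | hj
    · subst hj
      simp only [Nat.factorial_zero, Nat.cast_one, pow_zero, mul_one, one_mul, norm_iteratedFDeriv_zero]
      exact hM x
    · have h1 := hD j x
      have h2 : (2 * Real.exp 1 / r) ^ j ≤ (K₁ * Θ') ^ j * (lam (u t))⁻¹ ^ j := by
        rw [← mul_pow]; exact pow_le_pow_left₀ (by positivity) hratio j
      have h3 : K₀ ≤ K₀ ^ j := le_self_pow₀ hK₀1 (Nat.pos_iff_ne_zero.1 hj)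
      have hq0 : 0 ≤ (2 * Real.exp 1 / r) ^ j := pow_nonneg (div_nonneg (by positivity) hr.le) j
      have hB0 : 0 ≤ c₀ * N' * Real.exp 1 := by positivity
      calc ‖iteratedFDeriv ℝ j (u t) x‖ ≤ c₀ * N' * Real.exp 1 * (2 * Real.exp 1 / r) ^ j * j ! := h1
        _ ≤ K₀ * M * ((K₁ * Θ') ^ j * (lam (u t))⁻¹ ^ j) * j ! :=
            mul_le_mul_of_nonneg_right (mul_le_mul hBle h2 hq0 (by positivity)) (by positivity)
        _ ≤ K₀ ^ j * M * ((K₁ * Θ') ^ j * (lam (u t))⁻¹ ^ j) * j ! :=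
            mul_le_mul_of_nonneg_right (mul_le_mul_of_nonneg_right
              (mul_le_mul_of_nonneg_right h3 hM0.le) (by positivity)) (by positivity)
        _ = ((j ! : ℝ) * ρ⁻¹ ^ j) * M * (lam (u t))⁻¹ ^ j := by rw [hρinv, mul_pow, mul_pow]; ring
  -- admissibility, sparseness
  set B₁ : ℝ := ((1 ! : ℝ) * ρ⁻¹ ^ 1) * M * (lam (u t))⁻¹ ^ 1 with hB₁def
  have hAdm : IsAdm (u t) M B₁ := by
    refine ⟨hsol.contDiff_velocity htI, hsol.divFree _ htI, hM, fun x => ?_,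
      lintegral_iteratedFDeriv_slice_lt_top hν hT hsol hLH hdec htI 0,
      lintegral_iteratedFDeriv_slice_lt_top hν hT hsol hLH hdec htI 1,
      lintegral_iteratedFDeriv_slice_lt_top hν hT hsol hLH hdec htI 2⟩
    rw [← norm_iteratedFDeriv_one (𝕜 := ℝ)]
    exact hAn 1 x
  have hSparse : IsSparse Nsp (u t) M := by
    show Wpa (u t) * lam (u t) ≤ Θ' ^ 2 * N₁ / cL ^ 2 * M ^ 2
    have hlam2 : lam (u t) ^ 2 = Z / P := by rw [hlamZP, Real.sq_sqrt (div_pos hZ hP).le]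
    exact palinstrophy_mul_length_le hν hTt hZ hP hcL hΘ'1 (le_trans zero_le_one hN₁1) hlam hlam2 hlamL hsparse' hpinl
  exact ⟨t, M, B₁, htI, hAdm, hAn, hSparse, hpos, heff⟩

end Summit.NavierStokesRegularity.NavierStokesRegularity.Theorems.NearExtremalTransiencePerFlow.AnalyticGap

end
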